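import Mathlib.Data.Int.Log
import Literature.Geometry.Lorentzian.KerrConvergence
import HarnessLib

/-!
# Scale-invariant `Cᵏ` deviation on chart shells (route `StarvedNecks` of `FinalStateConjecture`)

The **shell deviation** wanted by route `StarvedNecks` of the summit `FinalStateConjecture`
(work item `defn-ShellDeviation`, definition request D1 of
`Summits/FinalStateConjecture/FinalStateConjecture/Theses/StarvedNecks.lean`):

> the scale-invariant weighted `Cᵏ` deviation `Σ_{m ≤ k} (2ʲ)ᵐ sup ‖Dᵐ(Ψ^*g − g_B)‖` of a chart
> `Ψ` from a `ModelBackground` `B` on the dyadic chart shell `{t = τ, 2ʲ ≤ r ≤ 2ʲ⁺¹}` (over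
> `supCkENorm` / `deviationExtend` of `KerrConvergence`),

needed to state the layer-2 children `NeckStarvationBudget` / `AnnularSmallData` of the crux
`NecksCertify` ("on every dyadic shell of the neck the scale-invariant weighted deviation from
the hole's own boosted Kerr tends to `0`"; "shell data `ε`-close on `{2ʲ ≤ rᵢ ≤ 2ʲ⁺²}`") and the
route's kill criterion ("the scale-invariant shell deviation on `{R₀ ≤ r ≤ ρ(τ)}` does not tend
to zero").

## Contents (namespace `Literature.Geometry.Lorentzian`)

* `scaleCkENorm S k ρ f = Σ_{m ≤ k} ρᵐ · sup_{x ∈ S} ‖Dᵐ f(x)‖ ∈ [0, ∞]` — the `Cᵏ` norm of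
  `f : F → G` over `S ⊆ F` **at scale `ρ`**: the `m`-th derivative carries the weight `ρᵐ`, so
  that the quantity is invariant under the dilation `x ↦ ρx` (`Dᵐ(f ∘ ρ·) = ρᵐ (Dᵐ f) ∘ ρ·`).
  Generic normed spaces, Mathlib's `iteratedFDeriv`, values in `ℝ≥0∞` (no boundedness needed
  to *define* it), exactly as `supCkENorm` (`KerrConvergence`) of which it is the scale-weighted,
  summed-over-orders variant, and as `Minkowski.nearCkNorm` (`RecedingKerrInitialLayerNorm`,
  the same shape on one fixed layer).
* `ModelBackground.shellTimeSlab B ρ₁ ρ₂ τ = {x ∈ U | t(x) = τ, ρ₁ ≤ r(x) ≤ ρ₂}` — the **chart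
  shell** of the slab `{t = τ}` between the chart radii `ρ₁` and `ρ₂`, and its dyadic instance
  `ModelBackground.dyadicShell B j τ = {t = τ, 2ʲ ≤ r ≤ 2ʲ⁺¹}`, `j : ℤ` (the masses `Mᵢ > 0` of a
  `FinalStateDecomposition` are not normalised, so shells below radius `1` must be nameable);
  `iUnion_dyadicShell`: the dyadic shells cover the punctured slab `{t = τ, 0 < r}`.
* `Spacetime.shellDeviationCk 𝓢 B Ψ k ρ₁ ρ₂ τ` — the **scale-invariant `Cᵏ` shell deviation**
  `Σ_{m ≤ k} ρ₁ᵐ · sup_{t = τ, ρ₁ ≤ r ≤ ρ₂} ‖Dᵐ(Ψ^*g − g_B)‖` of the chart `Ψ : U → 𝓢` from the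
  background `B` (`scaleCkENorm` of `Spacetime.deviationExtend` over the image of the shell in
  `E4`, weight = the scale `ρ₁` of the inner radius), and the requested dyadic instance
  `Spacetime.dyadicShellDeviationCk 𝓢 B Ψ k j τ = Σ_{m ≤ k} (2ʲ)ᵐ sup_{t = τ, 2ʲ ≤ r ≤ 2ʲ⁺¹}
  ‖Dᵐ(Ψ^*g − g_B)‖` (D1 verbatim).
* `FinalStateDecomposition.shellDeviationCk d i k ρ₁ ρ₂ τ` — the shell deviation of hole `i` of
  an `N`-hole final-state decomposition from ITS OWN boosted Kerr `(Mᵢ, aᵢ, Λᵢ, cᵢ)` (the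
  quantity of `NeckStarvationBudget`), with the sanity theorem
  `FinalStateDecomposition.tendsto_shellDeviationCk`: every shell of BOUNDED outer radius is
  already certified by the structure's own near-zone clause `tendsto_truncDeviationCk` — the
  content of the route's neck statements is exactly the case of shells whose scale grows with `τ`.

## API (all proved)

`scaleCkENorm`: vanishing on `f = 0`, on `S = ∅`, when `f` vanishes on an open neighbourhood of
`S` (all `k`) or on `S` itself (`k = 0`); monotone in the set, in the order `k`, in the scale
`ρ ≥ 0`, and `ρ ↦ |ρ|`; the pointwise bound `ρᵐ ‖Dᵐ f(x)‖ ≤ scaleCkENorm S k ρ f` (`m ≤ k`,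
`x ∈ S`); the two comparisons with the unweighted norm, `supCkENorm S k f ≤ scaleCkENorm S k ρ f`
for `1 ≤ ρ` and `scaleCkENorm S k ρ f ≤ (k + 1) · max(1, |ρ|)ᵏ · supCkENorm S k f` for every `ρ`.
Shells: membership lemmas, `shell ⊆ truncated slab ⊆ slab`, monotonicity in the radii, emptiness
for `ρ₂ < ρ₁`, gluing of consecutive shells, the dyadic cover. Shell deviation (the request's
API): unfolding lemmas, pointwise bound, monotonicity in `k` and `ρ₂`, value `0` for exact charts
(`Ψ^*g = g_B` on the domain: every `k`; on an open neighbourhood of the shell: every `k`; on the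
shell only: `k = 0`), the unweighted sup over the shell is `≤` the shell deviation at scales
`ρ₁ ≥ 1` / dyadic indices `j ≥ 0`, domination by `(k + 1) max(1, |ρ₁|)ᵏ · truncDeviationCk k ρ₂ τ`,
and the resulting `Tendsto` statements.

## Sources and status

The shell deviation has NO printed formulation as such: it is posited by the route (planner of
`StarvedNecks`, 2026-08-15) as the bookkeeping quantity of its "starved neck" mechanism, and
nothing is asserted about it here beyond the elementary API. Its ingredients are standard:

* weighted norms in which the `m`-th derivative carries `m` extra powers of the radius —
  Bartnik, CPAM 39 (1986), §1 (the weighted Sobolev spaces `W^{k,p}_δ`, one power of the weight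
  `σ = (1 + |x|²)^{1/2}` per derivative, and the scaling `u_R(x) = u(Rx)` of the annuli `A_R` to
  the unit annulus by which the weighted inequalities are proved; the tree's `weightedCkSeminorm`
  and `supCkENorm` cite the same section): on a shell `{ρ ≤ r ≤ 2ρ}` the weight `r^m` is `ρ^m` up
  to the factor `2^m`, which is the frozen-scale form used here;
* the deviation `Ψ^*g − g_B` of a late-time chart from its model background in consequence
  form — Dafermos–Holzegel–Rodnianski–Taylor, arXiv:2104.08222, §1 (as in `KerrConvergence`);
* external-region ("far from the hole", `{r ≥ R₀}`, `M/R₀ ≪ 1`) stability statements, whose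
  smallness is measured shell by shell in scale-invariant norms: Klainerman–Nicolò 2003 (Minkowski
  exterior), Caciotta–Nicolò, AHP 11 (2010), Shen, arXiv:2211.15230 / arXiv:2303.12758 — these
  enter the PROOFS the route plans, not this definition.

## Mathlib

No weighted `Cᵏ` classes in Mathlib (cf. `WeightedNorms`); used are `iteratedFDeriv`, `‖·‖ₑ`,
`Finset.sum`, `⨆`, `ENNReal.ofReal`, `Int.log` (dyadic cover), `Filter.Tendsto`.

## Design choices

* **Sum over orders, weight frozen at the inner radius** (the request's `Σ_{m ≤ k} (2ʲ)ᵐ sup ‖Dᵐ…‖`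
  verbatim), rather than `sup_m` / the pointwise weight `r(x)^m`: on a shell of bounded ratio
  `ρ₂/ρ₁` all these are equivalent up to constants depending on `k` and the ratio only; the
  frozen weight keeps the quantity an honest function of `supCkENorm`-type sups
  (`shellDeviationCk_le_mul_truncDeviationCk`).
* **General shell `[ρ₁, ρ₂]` first, dyadic shell as an instance**: the route itself needs
  `{2ʲ ≤ r ≤ 2ʲ⁺²}` (two dyadic shells, `AnnularSmallData`) and `{R₀ ≤ r ≤ ρ(τ)}` (kill criterion)
  besides `{2ʲ ≤ r ≤ 2ʲ⁺¹}`; no generality beyond that is introduced.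
* **Junk values**: `ρ₂ < ρ₁` gives the empty shell and deviation `0` (`shellDeviationCk_of_lt`);
  a scale `ρ₁ ≤ 0` is never intended (`ENNReal.ofReal` of a negative odd power is `0`, so only
  the orders with `ρ₁ᵐ ≥ 0` are counted) — all comparison lemmas are stated so as to hold for every
  real `ρ₁` nonetheless (`max 1 |ρ₁|`).
* Time `t` and radius `r` are those of the `ModelBackground` (`B.time`, `B.radius`): Kerr–Schild
  `t* = x⁰`, `r = r_a(x)` for `Kerr.background`, rest-frame ones for `boostedKerrBackground`,
  `x⁰` and `|x̲|` for `Minkowski.backgroundOn U`.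

## Not here

No statement of the route (`NeckStarvationBudget`, `AnnularSmallData`, the kill criterion) and no
flux / luminosity functional (request D2, `TubeLuminosity`, is a separate item); no claim that any
spacetime has small shell deviation at growing scales.
-/

noncomputable section

open TopologicalSpace Filter Topology
open scoped Topology ENNReal

universe u

namespace Literature.Geometry.Lorentzian

/-! ### `Cᵏ` norms at a scale -/

section ScaleNorm

variable {F G : Type*} [NormedAddCommGroup F] [NormedSpace ℝ F] [NormedAddCommGroup G]
  [NormedSpace ℝ G]

/-- The **`Cᵏ` (extended) norm at scale `ρ`** of `f : F → G` over `S ⊆ F`: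
`Σ_{m ≤ k} ρᵐ · sup_{x ∈ S} ‖Dᵐ f(x)‖ ∈ [0, ∞]`, with Mathlib's `iteratedFDeriv` (only smooth `f`
on open neighbourhoods of `S` are intended). The weight `ρᵐ` on the `m`-th derivative makes the
quantity dilation invariant; it is the weight `(1 + ‖x‖)^m` of the tree's weighted `Cᵏ`
seminorm `weightedCkSeminorm · k 0` (`WeightedNorms`, after the weighted spaces of Bartnik,
CPAM 39 (1986), §1), frozen at the scale `ρ` of a shell `{ρ ≤ r ≤ 2ρ}` — the form such norms
take after Bartnik's scaling `u_ρ(x) = u(ρx)` of the annulus `{ρ ≤ r ≤ 2ρ}` to the unit one.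
For `ρ < 0` the odd orders get the junk weight `ENNReal.ofReal (ρ^m) = 0` (never intended).
[cite: Bartnik1986, §1] -/
def scaleCkENorm (S : Set F) (k : ℕ) (ρ : ℝ) (f : F → G) : ℝ≥0∞ :=
  ∑ m ∈ Finset.range (k + 1), ENNReal.ofReal (ρ ^ m) * ⨆ x ∈ S, ‖iteratedFDeriv ℝ m f x‖ₑ

/-- The scaled `Cᵏ` norm of the zero function vanishes (Bartnik 1986, §1).
[cite: Bartnik1986, §1] -/
@[simp]
theorem scaleCkENorm_zero (S : Set F) (k : ℕ) (ρ : ℝ) : scaleCkENorm S k ρ (0 : F → G) = 0 := by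
  simp [scaleCkENorm, enorm_eq_nnnorm]

/-- The scaled `Cᵏ` norm over the empty set vanishes (Bartnik 1986, §1).
[cite: Bartnik1986, §1] -/
@[simp]
theorem scaleCkENorm_empty (k : ℕ) (ρ : ℝ) (f : F → G) : scaleCkENorm (∅ : Set F) k ρ f = 0 := by
  simp [scaleCkENorm]

/-- The scaled `Cᵏ` norm is monotone in the set (Bartnik 1986, §1). [cite: Bartnik1986, §1] -/
theorem scaleCkENorm_mono {S T : Set F} (h : S ⊆ T) (k : ℕ) (ρ : ℝ) (f : F → G) :
    scaleCkENorm S k ρ f ≤ scaleCkENorm T k ρ f :=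
  Finset.sum_le_sum fun _ _ ↦ mul_le_mul_right (iSup_le_iSup_of_subset h) _

/-- The scaled `Cᵏ` norm is monotone in the order `k` (Bartnik 1986, §1).
[cite: Bartnik1986, §1] -/
theorem scaleCkENorm_mono_right (S : Set F) {k k' : ℕ} (h : k ≤ k') (ρ : ℝ) (f : F → G) :
    scaleCkENorm S k ρ f ≤ scaleCkENorm S k' ρ f :=
  Finset.sum_le_sum_of_subset (Finset.range_mono (Nat.succ_le_succ h))

/-- The scaled `Cᵏ` norm is monotone in the scale `ρ ≥ 0` (Bartnik 1986, §1).
[cite: Bartnik1986, §1] -/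
theorem scaleCkENorm_mono_scale (S : Set F) (k : ℕ) {ρ ρ' : ℝ} (h₀ : 0 ≤ ρ) (h : ρ ≤ ρ')
    (f : F → G) : scaleCkENorm S k ρ f ≤ scaleCkENorm S k ρ' f :=
  Finset.sum_le_sum fun m _ ↦
    mul_le_mul_left (ENNReal.ofReal_le_ofReal (pow_le_pow_left₀ h₀ h m)) _

/-- Replacing the scale by its absolute value can only increase the scaled norm (the junk
negative scales are dominated by honest ones). Bartnik 1986, §1. [cite: Bartnik1986, §1] -/
theorem scaleCkENorm_le_abs (S : Set F) (k : ℕ) (ρ : ℝ) (f : F → G) :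
    scaleCkENorm S k ρ f ≤ scaleCkENorm S k |ρ| f :=
  Finset.sum_le_sum fun m _ ↦
    mul_le_mul_left (ENNReal.ofReal_le_ofReal ((le_abs_self _).trans_eq (abs_pow ρ m))) _

/-- Pointwise bound: `ρᵐ ‖Dᵐ f(x)‖ ≤ scaleCkENorm S k ρ f` for `m ≤ k` and `x ∈ S` — the form in
which a shell bound is consumed (Bartnik 1986, §1). [cite: Bartnik1986, §1] -/
theorem ofReal_mul_enorm_iteratedFDeriv_le_scaleCkENorm {S : Set F} {k m : ℕ} (hm : m ≤ k)
    {x : F} (hx : x ∈ S) (ρ : ℝ) (f : F → G) :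
    ENNReal.ofReal (ρ ^ m) * ‖iteratedFDeriv ℝ m f x‖ₑ ≤ scaleCkENorm S k ρ f :=
  calc ENNReal.ofReal (ρ ^ m) * ‖iteratedFDeriv ℝ m f x‖ₑ
      ≤ ENNReal.ofReal (ρ ^ m) * ⨆ x ∈ S, ‖iteratedFDeriv ℝ m f x‖ₑ :=
        mul_le_mul_right (le_biSup (fun x ↦ ‖iteratedFDeriv ℝ m f x‖ₑ) hx) _
    _ ≤ scaleCkENorm S k ρ f :=
        Finset.single_le_sum_of_canonicallyOrdered
          (f := fun m ↦ ENNReal.ofReal (ρ ^ m) * ⨆ x ∈ S, ‖iteratedFDeriv ℝ m f x‖ₑ)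
          (Finset.mem_range.mpr (Nat.lt_succ_of_le hm))

/-- At scales `ρ ≥ 1` the scaled `Cᵏ` norm dominates the unweighted `Cᵏ` sup norm `supCkENorm`
of `KerrConvergence` (Bartnik 1986, §1). [cite: Bartnik1986, §1] -/
theorem supCkENorm_le_scaleCkENorm (S : Set F) (k : ℕ) {ρ : ℝ} (hρ : 1 ≤ ρ) (f : F → G) :
    supCkENorm S k f ≤ scaleCkENorm S k ρ f := by
  refine iSup₂_le fun m hm ↦ ?_
  calc ⨆ x ∈ S, ‖iteratedFDeriv ℝ m f x‖ₑ
      ≤ ENNReal.ofReal (ρ ^ m) * ⨆ x ∈ S, ‖iteratedFDeriv ℝ m f x‖ₑ := by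
        refine le_mul_of_one_le_left' ?_
        rw [← ENNReal.ofReal_one]
        exact ENNReal.ofReal_le_ofReal (one_le_pow₀ hρ)
    _ ≤ scaleCkENorm S k ρ f :=
        Finset.single_le_sum_of_canonicallyOrdered
          (f := fun m ↦ ENNReal.ofReal (ρ ^ m) * ⨆ x ∈ S, ‖iteratedFDeriv ℝ m f x‖ₑ)
          (Finset.mem_range.mpr (Nat.lt_succ_of_le hm))

/-- At scales `ρ ≥ 1` the scaled `Cᵏ` norm is at most `(k + 1) ρᵏ` times the unweighted one
(Bartnik 1986, §1). [cite: Bartnik1986, §1] -/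
theorem scaleCkENorm_le_mul_supCkENorm_of_one_le (S : Set F) (k : ℕ) {ρ : ℝ} (hρ : 1 ≤ ρ)
    (f : F → G) :
    scaleCkENorm S k ρ f ≤ (k + 1) * ENNReal.ofReal (ρ ^ k) * supCkENorm S k f := by
  calc scaleCkENorm S k ρ f
      ≤ ∑ _m ∈ Finset.range (k + 1), ENNReal.ofReal (ρ ^ k) * supCkENorm S k f := by
        refine Finset.sum_le_sum fun m hm ↦ ?_
        have hm' : m ≤ k := Nat.lt_succ_iff.mp (Finset.mem_range.mp hm)
        exact mul_le_mul' (ENNReal.ofReal_le_ofReal (pow_le_pow_right₀ hρ hm'))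
          (iSup₂_le fun x hx ↦ enorm_iteratedFDeriv_le_supCkENorm hm' hx f)
    _ = (k + 1) * ENNReal.ofReal (ρ ^ k) * supCkENorm S k f := by
        rw [Finset.sum_const, Finset.card_range, nsmul_eq_mul, Nat.cast_add, Nat.cast_one,
          mul_assoc]

/-- For every real scale `ρ` the scaled `Cᵏ` norm is at most `(k + 1) · max(1, |ρ|)ᵏ` times the
unweighted `Cᵏ` sup norm; in particular it is finite, resp. small, when the latter is
(Bartnik 1986, §1). [cite: Bartnik1986, §1] -/
theorem scaleCkENorm_le_mul_supCkENorm (S : Set F) (k : ℕ) (ρ : ℝ) (f : F → G) :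
    scaleCkENorm S k ρ f ≤ (k + 1) * ENNReal.ofReal (max 1 |ρ| ^ k) * supCkENorm S k f :=
  calc scaleCkENorm S k ρ f
      ≤ scaleCkENorm S k |ρ| f := scaleCkENorm_le_abs S k ρ f
    _ ≤ scaleCkENorm S k (max 1 |ρ|) f :=
        scaleCkENorm_mono_scale S k (abs_nonneg ρ) (le_max_right _ _) f
    _ ≤ (k + 1) * ENNReal.ofReal (max 1 |ρ| ^ k) * supCkENorm S k f :=
        scaleCkENorm_le_mul_supCkENorm_of_one_le S k (le_max_left _ _) f

/-- Locality / exactness: if `f` vanishes on an open neighbourhood `V` of `S`, all its derivatives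
vanish on `S` and the scaled `Cᵏ` norm over `S` is `0` (Bartnik 1986, §1).
[cite: Bartnik1986, §1] -/
theorem scaleCkENorm_eq_zero_of_eqOn {S V : Set F} (hV : IsOpen V) (hSV : S ⊆ V) {f : F → G}
    (hf : Set.EqOn f 0 V) (k : ℕ) (ρ : ℝ) : scaleCkENorm S k ρ f = 0 := by
  have h0 : ∀ m : ℕ, ∀ x ∈ S, iteratedFDeriv ℝ m f x = 0 := fun m x hx ↦ by
    have hfx : f =ᶠ[𝓝 x] 0 := hf.eventuallyEq_of_mem (hV.mem_nhds (hSV hx))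
    rw [(hfx.iteratedFDeriv ℝ m).self_of_nhds, iteratedFDeriv_zero, Pi.zero_apply]
  refine Finset.sum_eq_zero fun m _ ↦ mul_eq_zero_of_right _ ?_
  exact ENNReal.iSup_eq_zero.mpr fun x ↦ ENNReal.iSup_eq_zero.mpr fun hx ↦ by
    simp [h0 m x hx, enorm_eq_nnnorm]

/-- At order `0` only the values ON `S` matter: if `f` vanishes on `S` then
`scaleCkENorm S 0 ρ f = 0` (Bartnik 1986, §1). [cite: Bartnik1986, §1] -/
theorem scaleCkENorm_zero_eq_zero_of_eqOn {S : Set F} {f : F → G} (hf : Set.EqOn f 0 S)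
    (ρ : ℝ) : scaleCkENorm S 0 ρ f = 0 := by
  rw [scaleCkENorm, zero_add, Finset.sum_range_one]
  refine mul_eq_zero_of_right _
    (ENNReal.iSup_eq_zero.mpr fun x ↦ ENNReal.iSup_eq_zero.mpr fun hx ↦ ?_)
  rw [← ofReal_norm, norm_iteratedFDeriv_zero, hf hx, Pi.zero_apply, norm_zero,
    ENNReal.ofReal_zero]

end ScaleNorm

/-! ### Chart shells of a reference background -/

namespace ModelBackground

/-- The **chart shell** `{x ∈ U | t(x) = τ, ρ₁ ≤ r(x) ≤ ρ₂}` of the slab `{t = τ}` of a reference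
background between the chart radii `ρ₁ ≤ ρ₂` (empty if `ρ₂ < ρ₁`): the part of the truncated slab
`truncTimeSlab ρ₂ τ` (DHRT arXiv:2104.08222, §1, `{t* = τ, r ≤ R}`) outside radius `ρ₁`; the
"neck" region of route `StarvedNecks` is a union of such shells. [cite: arXiv210408222, §1] -/
def shellTimeSlab (B : ModelBackground) (ρ₁ ρ₂ τ : ℝ) : Set B.domain :=
  {x | B.time x.1 = τ ∧ ρ₁ ≤ B.radius x.1 ∧ B.radius x.1 ≤ ρ₂}

/-- The **dyadic chart shell** `{x ∈ U | t(x) = τ, 2ʲ ≤ r(x) ≤ 2ʲ⁺¹}`, `j : ℤ` (request D1 of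
route `StarvedNecks`; dyadic decomposition in the radius as in Bartnik 1986, §1).
[cite: Bartnik1986, §1] -/
def dyadicShell (B : ModelBackground) (j : ℤ) (τ : ℝ) : Set B.domain :=
  B.shellTimeSlab ((2 : ℝ) ^ j) ((2 : ℝ) ^ (j + 1)) τ

/-- Membership in a chart shell (DHRT arXiv:2104.08222, §1). [cite: arXiv210408222, §1] -/
@[simp]
theorem mem_shellTimeSlab {B : ModelBackground} {ρ₁ ρ₂ τ : ℝ} {x : B.domain} :
    x ∈ B.shellTimeSlab ρ₁ ρ₂ τ ↔ B.time x.1 = τ ∧ ρ₁ ≤ B.radius x.1 ∧ B.radius x.1 ≤ ρ₂ :=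
  Iff.rfl

/-- Membership in a dyadic chart shell (Bartnik 1986, §1). [cite: Bartnik1986, §1] -/
@[simp]
theorem mem_dyadicShell {B : ModelBackground} {j : ℤ} {τ : ℝ} {x : B.domain} :
    x ∈ B.dyadicShell j τ ↔
      B.time x.1 = τ ∧ (2 : ℝ) ^ j ≤ B.radius x.1 ∧ B.radius x.1 ≤ (2 : ℝ) ^ (j + 1) :=
  Iff.rfl

/-- The dyadic shell is the chart shell `[2ʲ, 2ʲ⁺¹]` (Bartnik 1986, §1). [cite: Bartnik1986, §1] -/
theorem dyadicShell_eq (B : ModelBackground) (j : ℤ) (τ : ℝ) :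
    B.dyadicShell j τ = B.shellTimeSlab ((2 : ℝ) ^ j) ((2 : ℝ) ^ (j + 1)) τ :=
  rfl

/-- A chart shell lies in the truncated slab of its outer radius (DHRT arXiv:2104.08222, §1).
[cite: arXiv210408222, §1] -/
theorem shellTimeSlab_subset_truncTimeSlab (B : ModelBackground) (ρ₁ ρ₂ τ : ℝ) :
    B.shellTimeSlab ρ₁ ρ₂ τ ⊆ B.truncTimeSlab ρ₂ τ := fun _ hx ↦ ⟨hx.1, hx.2.2⟩

/-- A chart shell lies in the full slab (DHRT arXiv:2104.08222, §1). [cite: arXiv210408222, §1] -/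
theorem shellTimeSlab_subset_timeSlab (B : ModelBackground) (ρ₁ ρ₂ τ : ℝ) :
    B.shellTimeSlab ρ₁ ρ₂ τ ⊆ B.timeSlab τ := fun _ hx ↦ hx.1

/-- The chart shell is the part of the truncated slab outside the inner radius
(DHRT arXiv:2104.08222, §1). [cite: arXiv210408222, §1] -/
theorem truncTimeSlab_inter_setOf_le (B : ModelBackground) (ρ₁ ρ₂ τ : ℝ) :
    B.truncTimeSlab ρ₂ τ ∩ {x | ρ₁ ≤ B.radius x.1} = B.shellTimeSlab ρ₁ ρ₂ τ :=
  Set.ext fun _ ↦ ⟨fun h ↦ ⟨h.1.1, h.2, h.1.2⟩, fun h ↦ ⟨⟨h.1, h.2.2⟩, h.2.1⟩⟩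

/-- Chart shells grow when the inner radius decreases and the outer radius increases
(DHRT arXiv:2104.08222, §1). [cite: arXiv210408222, §1] -/
theorem shellTimeSlab_mono (B : ModelBackground) {ρ₁ ρ₁' ρ₂ ρ₂' : ℝ} (h₁ : ρ₁' ≤ ρ₁)
    (h₂ : ρ₂ ≤ ρ₂') (τ : ℝ) : B.shellTimeSlab ρ₁ ρ₂ τ ⊆ B.shellTimeSlab ρ₁' ρ₂' τ :=
  fun _ hx ↦ ⟨hx.1, h₁.trans hx.2.1, hx.2.2.trans h₂⟩

/-- A shell with `ρ₂ < ρ₁` is empty (documented junk case; DHRT arXiv:2104.08222, §1).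
[cite: arXiv210408222, §1] -/
theorem shellTimeSlab_eq_empty (B : ModelBackground) {ρ₁ ρ₂ : ℝ} (h : ρ₂ < ρ₁) (τ : ℝ) :
    B.shellTimeSlab ρ₁ ρ₂ τ = ∅ :=
  Set.eq_empty_of_forall_notMem fun _ hx ↦ absurd (hx.2.1.trans hx.2.2) (not_le.mpr h)

/-- Consecutive shells glue: `[ρ₁, ρ₂] ∪ [ρ₂, ρ₃] = [ρ₁, ρ₃]` for `ρ₁ ≤ ρ₂ ≤ ρ₃` (so
`{2ʲ ≤ r ≤ 2ʲ⁺²}` of `AnnularSmallData` is the union of two dyadic shells). Bartnik 1986, §1.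
[cite: Bartnik1986, §1] -/
theorem shellTimeSlab_union (B : ModelBackground) {ρ₁ ρ₂ ρ₃ : ℝ} (h₁₂ : ρ₁ ≤ ρ₂)
    (h₂₃ : ρ₂ ≤ ρ₃) (τ : ℝ) :
    B.shellTimeSlab ρ₁ ρ₂ τ ∪ B.shellTimeSlab ρ₂ ρ₃ τ = B.shellTimeSlab ρ₁ ρ₃ τ := by
  ext x
  simp only [Set.mem_union, mem_shellTimeSlab]
  constructor
  · rintro (⟨ht, hl, hr⟩ | ⟨ht, hl, hr⟩)
    exacts [⟨ht, hl, hr.trans h₂₃⟩, ⟨ht, h₁₂.trans hl, hr⟩]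
  · rintro ⟨ht, hl, hr⟩
    rcases le_total (B.radius x.1) ρ₂ with h | h
    exacts [Or.inl ⟨ht, hl, h⟩, Or.inr ⟨ht, h, hr⟩]

/-- The dyadic shells cover the punctured slab `{t = τ, 0 < r}` (every positive radius lies in
`[2ʲ, 2ʲ⁺¹]` for `j = ⌊log₂ r⌋`). Bartnik 1986, §1 (dyadic decomposition).
[cite: Bartnik1986, §1] -/
theorem iUnion_dyadicShell (B : ModelBackground) (τ : ℝ) :
    ⋃ j : ℤ, B.dyadicShell j τ = {x | B.time x.1 = τ ∧ 0 < B.radius x.1} := by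
  ext x
  simp only [Set.mem_iUnion, mem_dyadicShell, Set.mem_setOf_eq]
  constructor
  · rintro ⟨j, ht, hl, -⟩
    exact ⟨ht, (zpow_pos two_pos j).trans_le hl⟩
  · rintro ⟨ht, hr⟩
    refine ⟨Int.log 2 (B.radius x.1), ht, ?_, ?_⟩
    · exact_mod_cast Int.zpow_log_le_self (b := 2) one_lt_two hr
    · exact_mod_cast (Int.lt_zpow_succ_log_self (b := 2) one_lt_two (B.radius x.1)).le

end ModelBackground

/-! ### The scale-invariant shell deviation of a chart -/

namespace Spacetime

variable (𝓢 : Spacetime.{u} 4) (B : ModelBackground)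

/-- The **scale-invariant `Cᵏ` shell deviation** of the chart `Ψ : U → 𝓢` from the background
`B` on the chart shell `{t = τ, ρ₁ ≤ r ≤ ρ₂}`:
`Σ_{m ≤ k} ρ₁ᵐ · sup_{x ∈ U, t(x) = τ, ρ₁ ≤ r(x) ≤ ρ₂} ‖Dᵐ(Ψ^*g − g_B)(x)‖ ∈ [0, ∞]` — the scaled
norm `scaleCkENorm`, at the scale `ρ₁` of the inner radius, of the extended deviation
`Spacetime.deviationExtend` (DHRT arXiv:2104.08222, §1, consequence form as in `KerrConvergence`)
over the image of the shell in `E4`. Posited by route `StarvedNecks` (request D1); no printed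
formulation. Junk: `0` if `ρ₂ < ρ₁`; `ρ₁ ≤ 0` never intended. [cite: arXiv210408222, §1] -/
def shellDeviationCk (Ψ : B.domain → 𝓢.carrier) (k : ℕ) (ρ₁ ρ₂ τ : ℝ) : ℝ≥0∞ :=
  scaleCkENorm (Subtype.val '' B.shellTimeSlab ρ₁ ρ₂ τ) k ρ₁ (𝓢.deviationExtend B Ψ)

/-- The **dyadic shell deviation** (request D1 of route `StarvedNecks`, verbatim):
`Σ_{m ≤ k} (2ʲ)ᵐ · sup_{t = τ, 2ʲ ≤ r ≤ 2ʲ⁺¹} ‖Dᵐ(Ψ^*g − g_B)‖`, `j : ℤ` — the shell deviation on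
the dyadic chart shell at scale `2ʲ`. DHRT arXiv:2104.08222, §1 (deviation); Bartnik 1986, §1
(dyadic weights). [cite: arXiv210408222, §1] -/
def dyadicShellDeviationCk (Ψ : B.domain → 𝓢.carrier) (k : ℕ) (j : ℤ) (τ : ℝ) : ℝ≥0∞ :=
  𝓢.shellDeviationCk B Ψ k ((2 : ℝ) ^ j) ((2 : ℝ) ^ (j + 1)) τ

/-- Unfolding: the shell deviation is the scaled `Cᵏ` norm of the extended deviation over the
shell (DHRT arXiv:2104.08222, §1). [cite: arXiv210408222, §1] -/
theorem shellDeviationCk_eq (Ψ : B.domain → 𝓢.carrier) (k : ℕ) (ρ₁ ρ₂ τ : ℝ) :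
    𝓢.shellDeviationCk B Ψ k ρ₁ ρ₂ τ =
      ∑ m ∈ Finset.range (k + 1), ENNReal.ofReal (ρ₁ ^ m) *
        ⨆ x ∈ Subtype.val '' B.shellTimeSlab ρ₁ ρ₂ τ,
          ‖iteratedFDeriv ℝ m (𝓢.deviationExtend B Ψ) x‖ₑ :=
  rfl

/-- Unfolding: the dyadic shell deviation is the scaled norm at scale `2ʲ` over the dyadic
shell (DHRT arXiv:2104.08222, §1). [cite: arXiv210408222, §1] -/
theorem dyadicShellDeviationCk_eq (Ψ : B.domain → 𝓢.carrier) (k : ℕ) (j : ℤ) (τ : ℝ) :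
    𝓢.dyadicShellDeviationCk B Ψ k j τ =
      scaleCkENorm (Subtype.val '' B.dyadicShell j τ) k ((2 : ℝ) ^ j)
        (𝓢.deviationExtend B Ψ) :=
  rfl

/-- Pointwise reading of a shell bound: `ρ₁ᵐ ‖Dᵐ(Ψ^*g − g_B)(x)‖ ≤ shellDeviationCk … k ρ₁ ρ₂ τ`
for `m ≤ k` and `x` in the shell (DHRT arXiv:2104.08222, §1). [cite: arXiv210408222, §1] -/
theorem ofReal_mul_enorm_iteratedFDeriv_le_shellDeviationCk (Ψ : B.domain → 𝓢.carrier)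
    {k m : ℕ} (hm : m ≤ k) {ρ₁ ρ₂ τ : ℝ} {x : B.domain} (hx : x ∈ B.shellTimeSlab ρ₁ ρ₂ τ) :
    ENNReal.ofReal (ρ₁ ^ m) * ‖iteratedFDeriv ℝ m (𝓢.deviationExtend B Ψ) x‖ₑ ≤
      𝓢.shellDeviationCk B Ψ k ρ₁ ρ₂ τ :=
  ofReal_mul_enorm_iteratedFDeriv_le_scaleCkENorm hm (Set.mem_image_of_mem _ hx) _ _

/-- The shell deviation is monotone in the order `k` (DHRT arXiv:2104.08222, §1).
[cite: arXiv210408222, §1] -/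
theorem shellDeviationCk_mono (Ψ : B.domain → 𝓢.carrier) {k k' : ℕ} (h : k ≤ k')
    (ρ₁ ρ₂ τ : ℝ) : 𝓢.shellDeviationCk B Ψ k ρ₁ ρ₂ τ ≤ 𝓢.shellDeviationCk B Ψ k' ρ₁ ρ₂ τ :=
  scaleCkENorm_mono_right _ h _ _

/-- The shell deviation is monotone in the outer radius (DHRT arXiv:2104.08222, §1).
[cite: arXiv210408222, §1] -/
theorem shellDeviationCk_mono_right (Ψ : B.domain → 𝓢.carrier) (k : ℕ) (ρ₁ : ℝ) {ρ₂ ρ₂' : ℝ}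
    (h : ρ₂ ≤ ρ₂') (τ : ℝ) :
    𝓢.shellDeviationCk B Ψ k ρ₁ ρ₂ τ ≤ 𝓢.shellDeviationCk B Ψ k ρ₁ ρ₂' τ :=
  scaleCkENorm_mono (Set.image_mono (B.shellTimeSlab_mono le_rfl h τ)) _ _ _

/-- An inverted shell (`ρ₂ < ρ₁`) has deviation `0` (documented junk case;
DHRT arXiv:2104.08222, §1). [cite: arXiv210408222, §1] -/
theorem shellDeviationCk_of_lt (Ψ : B.domain → 𝓢.carrier) (k : ℕ) {ρ₁ ρ₂ : ℝ} (h : ρ₂ < ρ₁)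
    (τ : ℝ) : 𝓢.shellDeviationCk B Ψ k ρ₁ ρ₂ τ = 0 := by
  rw [shellDeviationCk, B.shellTimeSlab_eq_empty h, Set.image_empty, scaleCkENorm_empty]

/-- **Exact charts have vanishing shell deviation**: if `Ψ^*g = g_B` on the whole chart domain
(`Spacetime.deviation B Ψ = 0`), every shell deviation is `0` — e.g. the identity chart of an
exactly Kerr or exactly Minkowskian region. DHRT arXiv:2104.08222, §1. [cite: arXiv210408222, §1] -/
theorem shellDeviationCk_eq_zero_of_deviation_eq_zero (Ψ : B.domain → 𝓢.carrier)
    (h : ∀ x, 𝓢.deviation B Ψ x = 0) (k : ℕ) (ρ₁ ρ₂ τ : ℝ) :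
    𝓢.shellDeviationCk B Ψ k ρ₁ ρ₂ τ = 0 := by
  have h0 : 𝓢.deviationExtend B Ψ = 0 := by
    funext y
    by_cases hy : y ∈ B.domain
    · exact (𝓢.deviationExtend_coe B Ψ ⟨y, hy⟩).trans (h ⟨y, hy⟩)
    · exact 𝓢.deviationExtend_of_not_mem B Ψ hy
  rw [shellDeviationCk, h0, scaleCkENorm_zero]

/-- **Local exactness**: if the (extended) deviation vanishes on an open set `V ⊆ E4` containing
the shell, the `Cᵏ` shell deviation is `0` for every `k` — derivatives of order `≥ 1` transversal
to the shell see a neighbourhood, so vanishing ON the shell alone only gives the order-`0`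
statement `shellDeviationCk_zero_eq_zero`. DHRT arXiv:2104.08222, §1. [cite: arXiv210408222, §1] -/
theorem shellDeviationCk_eq_zero_of_eqOn (Ψ : B.domain → 𝓢.carrier) {V : Set E4} (hV : IsOpen V)
    (k : ℕ) {ρ₁ ρ₂ τ : ℝ} (hsub : Subtype.val '' B.shellTimeSlab ρ₁ ρ₂ τ ⊆ V)
    (h : Set.EqOn (𝓢.deviationExtend B Ψ) 0 V) : 𝓢.shellDeviationCk B Ψ k ρ₁ ρ₂ τ = 0 :=
  scaleCkENorm_eq_zero_of_eqOn hV hsub h k ρ₁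

/-- **Order `0`**: if `Ψ^*g = g_B` at every point of the shell, the `C⁰` shell deviation vanishes
(the request's "value `0` when `Ψ^*g = B.bilin` on the shell"; for `k ≥ 1` see
`shellDeviationCk_eq_zero_of_eqOn`). DHRT arXiv:2104.08222, §1. [cite: arXiv210408222, §1] -/
theorem shellDeviationCk_zero_eq_zero (Ψ : B.domain → 𝓢.carrier) {ρ₁ ρ₂ τ : ℝ}
    (h : ∀ x ∈ B.shellTimeSlab ρ₁ ρ₂ τ, 𝓢.deviation B Ψ x = 0) :
    𝓢.shellDeviationCk B Ψ 0 ρ₁ ρ₂ τ = 0 := by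
  refine scaleCkENorm_zero_eq_zero_of_eqOn (fun y hy ↦ ?_) ρ₁
  obtain ⟨x, hx, rfl⟩ := hy
  rw [deviationExtend_coe, Pi.zero_apply]
  exact h x hx

/-- On shells of scale `ρ₁ ≥ 1` the shell deviation dominates the unweighted `Cᵏ` sup norm of
the deviation over the shell (DHRT arXiv:2104.08222, §1). [cite: arXiv210408222, §1] -/
theorem supCkENorm_le_shellDeviationCk (Ψ : B.domain → 𝓢.carrier) (k : ℕ) {ρ₁ : ℝ}
    (hρ : 1 ≤ ρ₁) (ρ₂ τ : ℝ) :
    supCkENorm (Subtype.val '' B.shellTimeSlab ρ₁ ρ₂ τ) k (𝓢.deviationExtend B Ψ) ≤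
      𝓢.shellDeviationCk B Ψ k ρ₁ ρ₂ τ :=
  supCkENorm_le_scaleCkENorm _ k hρ _

/-- On dyadic shells of index `j ≥ 0` (scale `2ʲ ≥ 1`) the dyadic shell deviation dominates the
unweighted `Cᵏ` sup norm of the deviation over the shell (the request's API item).
DHRT arXiv:2104.08222, §1. [cite: arXiv210408222, §1] -/
theorem supCkENorm_le_dyadicShellDeviationCk (Ψ : B.domain → 𝓢.carrier) (k : ℕ) {j : ℤ}
    (hj : 0 ≤ j) (τ : ℝ) :
    supCkENorm (Subtype.val '' B.dyadicShell j τ) k (𝓢.deviationExtend B Ψ) ≤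
      𝓢.dyadicShellDeviationCk B Ψ k j τ :=
  𝓢.supCkENorm_le_shellDeviationCk B Ψ k (one_le_zpow₀ one_le_two hj) _ τ

/-- **Fixed-radius control of shells**: the shell deviation on `{t = τ, ρ₁ ≤ r ≤ ρ₂}` is at most
`(k + 1) max(1, |ρ₁|)ᵏ` times the near-zone `Cᵏ` deviation `truncDeviationCk k ρ₂ τ` on the
truncated slab `{t = τ, r ≤ ρ₂}` (DHRT arXiv:2104.08222, §1). [cite: arXiv210408222, §1] -/
theorem shellDeviationCk_le_mul_truncDeviationCk (Ψ : B.domain → 𝓢.carrier) (k : ℕ)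
    (ρ₁ ρ₂ τ : ℝ) :
    𝓢.shellDeviationCk B Ψ k ρ₁ ρ₂ τ ≤
      (k + 1) * ENNReal.ofReal (max 1 |ρ₁| ^ k) * 𝓢.truncDeviationCk B Ψ k ρ₂ τ :=
  (scaleCkENorm_le_mul_supCkENorm _ k ρ₁ _).trans (mul_le_mul_right
    (supCkENorm_mono (Set.image_mono (B.shellTimeSlab_subset_truncTimeSlab ρ₁ ρ₂ τ)) _ _) _)

variable {𝓢 B}

/-- **Near-zone convergence certifies every shell of bounded outer radius**: if the `Cᵏ`
deviation on the truncated slabs `{t = τ, r ≤ ρ₂}` tends to `0` as `τ → ∞`, so does the shell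
deviation on `{t = τ, ρ₁ ≤ r ≤ ρ₂}` for every `ρ₁`. (The neck statements of route `StarvedNecks`
concern shells whose radii grow with `τ`, which this does NOT cover.) DHRT arXiv:2104.08222, §1.
[cite: arXiv210408222, §1] -/
theorem tendsto_shellDeviationCk_of_tendsto_truncDeviationCk {Ψ : B.domain → 𝓢.carrier}
    {k : ℕ} (ρ₁ : ℝ) {ρ₂ : ℝ}
    (h : Tendsto (fun τ ↦ 𝓢.truncDeviationCk B Ψ k ρ₂ τ) atTop (𝓝 0)) :
    Tendsto (fun τ ↦ 𝓢.shellDeviationCk B Ψ k ρ₁ ρ₂ τ) atTop (𝓝 0) := by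
  have hC : ((k : ℝ≥0∞) + 1) * ENNReal.ofReal (max 1 |ρ₁| ^ k) ≠ ⊤ :=
    ENNReal.mul_ne_top (ENNReal.add_ne_top.mpr ⟨ENNReal.natCast_ne_top k, ENNReal.one_ne_top⟩)
      ENNReal.ofReal_ne_top
  have h' := ENNReal.Tendsto.const_mul h (Or.inr hC)
  rw [mul_zero] at h'
  exact tendsto_of_tendsto_of_tendsto_of_le_of_le tendsto_const_nhds h' (fun _ ↦ zero_le)
    fun τ ↦ 𝓢.shellDeviationCk_le_mul_truncDeviationCk B Ψ k ρ₁ ρ₂ τ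

/-- The dyadic shell deviation of bounded index is certified by near-zone convergence at the
outer radius `2ʲ⁺¹` (DHRT arXiv:2104.08222, §1). [cite: arXiv210408222, §1] -/
theorem tendsto_dyadicShellDeviationCk_of_tendsto_truncDeviationCk {Ψ : B.domain → 𝓢.carrier}
    {k : ℕ} (j : ℤ)
    (h : Tendsto (fun τ ↦ 𝓢.truncDeviationCk B Ψ k ((2 : ℝ) ^ (j + 1)) τ) atTop (𝓝 0)) :
    Tendsto (fun τ ↦ 𝓢.dyadicShellDeviationCk B Ψ k j τ) atTop (𝓝 0) :=
  tendsto_shellDeviationCk_of_tendsto_truncDeviationCk _ h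

end Spacetime

/-! ### The shell deviation of a hole of a final-state decomposition -/

namespace FinalStateDecomposition

variable {𝓢 : Spacetime.{u} 4} {𝒟 : Set 𝓢.carrier} {k : ℕ}

/-- The **shell deviation of hole `i`** of an `N`-hole final-state decomposition from ITS OWN
boosted Kerr `(Mᵢ, aᵢ, Λᵢ, cᵢ)`, in `C^{k'}`, on the chart shell `{t*ᵢ = τ, ρ₁ ≤ rᵢ ≤ ρ₂}` of its
rest-frame Kerr–Schild time and radius (the quantity bounded shell by shell in
`NeckStarvationBudget` of route `StarvedNecks`). Folklore final state picture, Klainerman, "Brief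
history of the black hole stability problem", §4 (as `FinalStateDecomposition`). [folklore] -/
def shellDeviationCk (d : FinalStateDecomposition 𝓢 𝒟 k) (i : Fin d.N) (k' : ℕ)
    (ρ₁ ρ₂ τ : ℝ) : ℝ≥0∞ :=
  𝓢.shellDeviationCk (d.background i) (d.chart i) k' ρ₁ ρ₂ τ

/-- Unfolding of the hole shell deviation (Klainerman, §4). [folklore] -/
theorem shellDeviationCk_eq (d : FinalStateDecomposition 𝓢 𝒟 k) (i : Fin d.N) (k' : ℕ)
    (ρ₁ ρ₂ τ : ℝ) :
    d.shellDeviationCk i k' ρ₁ ρ₂ τ = 𝓢.shellDeviationCk (d.background i) (d.chart i) k' ρ₁ ρ₂ τ :=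
  rfl

/-- **Sanity: fixed shells are already certified.** For every hole `i` and all FIXED radii
`ρ₁, ρ₂`, the `Cᵏ` shell deviation from its boosted Kerr tends to `0` as `τ → ∞` — a consequence
of the structure's own near-zone clause `tendsto_truncDeviationCk i ρ₂`; the route's neck
statements add content only for radii growing with `τ`. DHRT arXiv:2104.08222, §1 (near-zone
convergence). [cite: arXiv210408222, §1] -/
theorem tendsto_shellDeviationCk (d : FinalStateDecomposition 𝓢 𝒟 k) (i : Fin d.N)
    (ρ₁ ρ₂ : ℝ) : Tendsto (fun τ ↦ d.shellDeviationCk i k ρ₁ ρ₂ τ) atTop (𝓝 0) :=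
  Spacetime.tendsto_shellDeviationCk_of_tendsto_truncDeviationCk ρ₁
    (d.tendsto_truncDeviationCk i ρ₂)

/-- In lower regularity `k' ≤ k` fixed shells are certified as well (DHRT arXiv:2104.08222, §1).
[cite: arXiv210408222, §1] -/
theorem tendsto_shellDeviationCk_of_le (d : FinalStateDecomposition 𝓢 𝒟 k) (i : Fin d.N)
    {k' : ℕ} (hk : k' ≤ k) (ρ₁ ρ₂ : ℝ) :
    Tendsto (fun τ ↦ d.shellDeviationCk i k' ρ₁ ρ₂ τ) atTop (𝓝 0) :=
  tendsto_of_tendsto_of_tendsto_of_le_of_le tendsto_const_nhds (d.tendsto_shellDeviationCk i ρ₁ ρ₂)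
    (fun _ ↦ zero_le) fun τ ↦ 𝓢.shellDeviationCk_mono (d.background i) (d.chart i) hk ρ₁ ρ₂ τ

end FinalStateDecomposition

end Literature.Geometry.Lorentzian

end
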